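import Literature.MathematicalPhysics.QuantumFieldTheory.Balaban1983to89.B9Ineq347Reading
import Literature.MathematicalPhysics.QuantumFieldTheory.Balaban1983to89.B9Ineq347GAAtLetters

/-!
# `Balaban1983to89.B9GlobReadingOrphan` — [B9] (3.42) ⇒ (3.47) at the geometry of record: the reading structure `GlobReading` of G(1)
# is REFUTED at every member carrying an «orphan» block (a block of 𝔅 that is the carrier block of no index bond)

T. Bałaban, *Propagators for lattice gauge theories in a background field*, Commun. Math. Phys. **99** (1985) 389–434
[`Balaban1985BackgroundPropagators`, "B9"]; [4] = T. Bałaban, *Propagators and renormalization transformations for lattice gauge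
theories. II*, Commun. Math. Phys. **96** (1984) 223–250 [`Balaban1984PropagatorsII`].

statement-level skeleton of published theorems with citation tags; proofs where landed; nothing here is a claim about the
Yang–Mills mass gap

THE PRINTED LOCI.  (3.41)–(3.42) p. 397 (the weighted norm `|A|_{(α)} = sup_j sup_{b ∈ Ω_j∖Ω_{j+1}} (Lʲη)^{−α}|A(b)|` over ALL bonds; the local
entries *"for x ∈ Δ(y), y ∈ Λ_j, supp λ ⊂ Δ(y′)"* over ALL blocks y, y′ ∈ 𝔅); (3.47) p. 398; p. 398 *"It is easy to see that the global inequalities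
(3.47) are consequences of the local ones (3.42) and Lemma 2.1."*; Cor. 3.5 p. 407 *"For … U = 1, these theorems are proved in [4]"*; [4] (2.22)
p. 226 *"G = Δ_a⁻¹"*.

THE POINT (a located NEGATIVE about the RECORD'S READING, not about print).  At the geometry of record `B9GeoNormsKLevelV1.geo9K i` the
sites are the INDEX BONDS `c` ([4] «sites replaced by bonds»), and def-Y's reading `Node00.kernelFamilyB` of a bond-sector letter reads the n-th
(3.42) entry `e n U (J ⊗ ·) c` ON THE CARRIER BLOCK `β c` ONLY (`supInB (β c)`), while its (3.47) entry `glob n U (J ⊗ ·) γ` is the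
(3.41)-weighted sup over EVERY fine bond (`wNormBY`).  n06-h's hypothesis structure `B9Ineq347Reading.GlobReading K P U res` — the reading
axioms behind «(3.47) from (3.42) + Lemma 2.1», displayed as the binders `hRGA` (row 12), `hRGp` (row 11), `hread` (rows 20–21) of the N06
knit — asks in its field `glob_le` that the weighted sup be `≤ C` as soon as every carrier-block reading is `≤ C·[…]_n·(Lʲη)^γ`.  If some block
`s ∈ 𝔅` is the carrier block of NO index bond (an ORPHAN block: `∀ c, β c ≠ s`; such members exist as typed — e.g. k = 2 with Ω₂ the d+1 big
blocks ahead of a big block Q ∉ Ω₂, s = the top-corner 1-block of the top-corner 2-block of Q, cell memo `ORPHAN-BLOCKS-MEMO.md`), this is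
FALSE for G(1): def-Y's letter record carries the printed U = 1 clause `CovLettersY.GA_one` (G(1)(J ⊗ E) = (Δ_a⁻¹J) ⊗ E with r03's genuine
`Gop = Δ_a⁻¹`, a two-sided inverse, `B6SectAVectorModelV1.GE_deltaAE`); with `K := 𝟙_{x₀}` for a fine bond `x₀` of the orphan block and
`J := Δ_a K`, every carrier-block reading of `G(1)(J ⊗ E) = K ⊗ E` VANISHES (so `C = 0` is admissible) whereas the weighted norm of `K ⊗ E₀`,
`E₀ = ‖1‖⁻¹·1`, is `≥ (L^{j(x₀)}η)⁻²·1 > 0`.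
* §1 reading lemmas: `supInB_liftY_eq_zero_of_off`, `Gop_onFun_deltaAE`, `bddBY`, `weight_mul_norm_le_wNormBY`, `wNormBY_liftY_le_wNormB`.
* §2 ★ `not_globReading_GA_one_of_orphan` — for EVERY letter record `𝔏 : CovLettersY 𝔸 x` (`𝔸` nontrivial), every `𝔈`, every `res`:
  `¬ GlobReading (operatorLayerYOfLetters 𝔸 G x 𝔏 𝔈).GA (fun λ => λ.isRight = true) (bg9Y 𝔸 G x).one res` at a member `x` with an orphan block.
* §3 ★ `not_hRGA_opsYOfLetters_of_orphan` — the same at the record (`𝔸 = Matrix (Fin N) (Fin N) ℂ`, `N ≥ 1`): the knit binder `hRGA x` is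
  unsatisfiable at such a member, for every `𝔏 𝔈`.
CONSEQUENCE FOR THE CELL: knit theorems carrying `hRGA` (∕ `hRGp` ∕ `hread`) are vacuous at members with orphan blocks; row 12 itself is
NOT affected — n06-h g2's `B9Ineq347GAAtLetters.hGA_opsYOfLetters` proves it WITHOUT `GlobReading`, from N03's census majorant on the BLOCK
geometry `geomT`∕`blkV1` (blocks, not index bonds: the right currency for (3.47)).  The existence of orphan members is NOT constructed here
(prose witness in the memo); this file is the implication «orphan block ⇒ ¬ GlobReading of G(1)».

HONEST SCOPE.  A negative about a displayed HYPOTHESIS SCHEMA of the cell at the record's reading; nothing of [B9] or [4] is asserted or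
denied (print's (3.42) speaks about all blocks of 𝔅, where no orphan phenomenon exists); count-neutral; N06 NOT discharged; one finite lattice
programme — nothing continuum, nothing about the mass gap.  Cell `pub-ymgap` (HUMAN RULING D-0062), Track A node N06 [B9], seat
`pub-ymgap-dag-n06-l` (g3), 2026-08-27.
-/

noncomputable section

namespace Literature.MathematicalPhysics.QuantumFieldTheory.Balaban1983to89.B9GlobReadingOrphan

open B6SectAOperatorsV1 (BondIdx)
open B6SectAVectorModelV1 (deltaAE GE GE_deltaAE)
open B6GlobalChartV1 (PV domT blkV1)
open B6Ineq2142KLevelV1 (β)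
open B6KLevelCensusIndexV1 (KIdx)
open B6Ineq2133TwoScaleV1 (onFun onFun_apply)
open B6Prop26Census2136KLevelV1 (Gop)
open B8ScaledSupNorm (weight msup Bdd weight_pos weight_nonneg weight_mul_norm_le_msup)
open B9GeoNormsKLevelV1 (wNormB wNormB_nonneg blkV1_level_le abs_le_of_wNormB_le)
open B9Ineq347Reading (GlobReading)
open B9Ineq347GAAtLetters (wNormBY_le_of_pointwise GA_glob_one_inr)
open B9PinMembersKLevelV1 (MemberY geo9Y bg9Y)
open B7Prop2SpecialUnitary (specialUnitaryUnits)
open Node00 (SiteY FBondY BlkY IBondY CfgY BallY liftY liftY_apply norm_liftY_le supInB wNormBY kernelFamilyB CovLettersY ExpLettersY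
  operatorLayerYOfLetters LettersY ExpsY opsYOfLetters Stage3Params)
open scoped Matrix

variable {d ℓ : ℕ} {hd : 1 ≤ d + 1} {hL : Odd (ℓ + 1) ∧ 1 < ℓ + 1} {b₀ b₁ : ℝ} {Mstar : ℕ}
variable {𝔸 : Type} [NormedRing 𝔸] [NormedAlgebra ℂ 𝔸] [CompleteSpace 𝔸]

/-! ## §1 Reading lemmas on one index -/

section Index

variable (i : KIdx d ℓ hd hL b₀ b₁)

omit [CompleteSpace 𝔸] in
/-- the block sup `sup_{x ∈ Δ(y)} ‖(K ⊗ E)(x)‖` VANISHES when `K` vanishes on the block `y`. [cite: Balaban1985BackgroundPropagators, (3.42) p.397 («for x ∈ Δ(y)»), bookkeeping] -/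
theorem supInB_liftY_eq_zero_of_off {K : FBondY i → ℝ} {y : BlkY i} (hK : ∀ x : FBondY i, blkV1 i.hN i.D x = y → K x = 0) (E : 𝔸) :
    supInB i y (liftY K E) = 0 := by
  unfold supInB
  refine le_antisymm (Real.iSup_le (fun x => ?_) le_rfl) (Real.iSup_nonneg fun _ => norm_nonneg _)
  rw [liftY_apply, hK x.1 x.2, Complex.ofReal_zero, zero_smul, norm_zero]

/-- **`G(Δ_a K) = K`** for r03's genuine `Gop = Δ_a⁻¹` on fine-bond functions ([4] (2.22) *"G = Δ_a⁻¹"*, a two-sided inverse).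
[cite: Balaban1984PropagatorsII, (2.22) p.226] -/
theorem Gop_onFun_deltaAE (K : FBondY i → ℝ) : Gop i (onFun (deltaAE (domT i.hN i.D i.hk) i.cf i.w) K) = K := by
  have h1 : onFun (deltaAE (domT i.hN i.D i.hk) i.cf i.w) K =
      WithLp.ofLp (deltaAE (domT i.hN i.D i.hk) i.cf i.w (WithLp.toLp 2 K)) := rfl
  have h2 : Gop i (onFun (deltaAE (domT i.hN i.D i.hk) i.cf i.w) K) =
      WithLp.ofLp (GE (domT i.hN i.D i.hk) i.hcf i.hw (WithLp.toLp 2 (onFun (deltaAE (domT i.hN i.D i.hk) i.cf i.w) K))) := rfl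
  rw [h2, h1, WithLp.toLp_ofLp, GE_deltaAE]

omit [NormedAlgebra ℂ 𝔸] [CompleteSpace 𝔸] in
/-- on the finite torus the (3.41)-weighted family of an `𝔸`-valued bond function is bounded (print's suprema are maxima).
[cite: Balaban1985BackgroundPropagators, (3.41) p.397, bookkeeping] -/
theorem bddBY (γ : ℝ) (Ψ : FBondY i → 𝔸) :
    Bdd (ℓ + 1) i.k |i.cf|⁻¹ γ (fun j (x : FBondY i) => (blkV1 i.hN i.D x).1.1 = j) Ψ := by
  classical
  refine ⟨∑ x : FBondY i, weight (ℓ + 1) |i.cf|⁻¹ γ (blkV1 i.hN i.D x).1.1 * ‖Ψ x‖, fun j _ x hx => ?_⟩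
  rw [← hx]
  exact Finset.single_le_sum (f := fun x => weight (ℓ + 1) |i.cf|⁻¹ γ (blkV1 i.hN i.D x).1.1 * ‖Ψ x‖)
    (fun x _ => mul_nonneg (weight_nonneg _ (inv_nonneg.2 (abs_nonneg _)) _ _) (norm_nonneg _)) (Finset.mem_univ x)

omit [NormedAlgebra ℂ 𝔸] [CompleteSpace 𝔸] in
/-- each weighted value is below the norm: `(L^{j(b)}|c_f|⁻¹)^{−γ}‖Ψ(b)‖ ≤ |Ψ|_{(γ)}` (def-Y's `wNormBY`). [cite: Balaban1985BackgroundPropagators, (3.41) p.397] -/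
theorem weight_mul_norm_le_wNormBY (γ : ℝ) (Ψ : FBondY i → 𝔸) (x : FBondY i) :
    weight (ℓ + 1) |i.cf|⁻¹ γ (blkV1 i.hN i.D x).1.1 * ‖Ψ x‖ ≤ wNormBY i γ Ψ :=
  weight_mul_norm_le_msup (bddBY i γ Ψ) (blkV1_level_le i x) rfl

/-- `|K ⊗ E|_{(γ)} ≤ |K|_{(γ)}` for `‖E‖ ≤ 1`. [cite: Balaban1985BackgroundPropagators, (3.41) p.397 + Cor. 3.5 p.407, bookkeeping] -/
theorem wNormBY_liftY_le_wNormB (γ : ℝ) (K : FBondY i → ℝ) (E : BallY 𝔸) : wNormBY i γ (liftY K (E : 𝔸)) ≤ wNormB i γ K := by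
  refine wNormBY_le_of_pointwise i (wNormB_nonneg i γ K) fun b => (norm_liftY_le K E b).trans ?_
  have h := abs_le_of_wNormB_le i (le_refl (wNormB i γ K)) b
  push_cast at h ⊢
  exact h

end Index

/-! ## §2 ★ At a member with an orphan block: `GlobReading` of G(1) is refuted, for every letter record -/

section Member

variable [Nontrivial 𝔸] {G : Subgroup 𝔸ˣ}
variable [∀ x : MemberY d ℓ hd hL b₀ b₁ Mstar, Fintype (geo9Y x).Site]
variable (x : MemberY d ℓ hd hL b₀ b₁ Mstar) (𝔏 : CovLettersY 𝔸 x) (𝔈 : ExpLettersY 𝔸 G x)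

omit [CompleteSpace 𝔸] in
/-- the unit direction `E₀ = ‖1‖⁻¹·1` of the ball (`𝔸` nontrivial). [cite: Balaban1985BackgroundPropagators, (3.39) p.397, bookkeeping] -/
private theorem unitDir_mem : ((‖(1 : 𝔸)‖⁻¹ : ℝ) : ℂ) • (1 : 𝔸) ∈ Metric.closedBall (0 : 𝔸) 1 := by
  have h1 : 0 < ‖(1 : 𝔸)‖ := norm_pos_iff.mpr one_ne_zero
  rw [mem_closedBall_zero_iff, norm_smul, Complex.norm_real, Real.norm_eq_abs, abs_of_pos (inv_pos.mpr h1), inv_mul_cancel₀ h1.ne']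

omit [CompleteSpace 𝔸] in
/-- the unit direction has norm one. [cite: Balaban1985BackgroundPropagators, (3.39) p.397, bookkeeping] -/
private theorem norm_unitDir : ‖((‖(1 : 𝔸)‖⁻¹ : ℝ) : ℂ) • (1 : 𝔸)‖ = 1 := by
  have h1 : 0 < ‖(1 : 𝔸)‖ := norm_pos_iff.mpr one_ne_zero
  rw [norm_smul, Complex.norm_real, Real.norm_eq_abs, abs_of_pos (inv_pos.mpr h1), inv_mul_cancel₀ h1.ne']

/-- ★ **`GlobReading` OF G(1) IS REFUTED AT A MEMBER WITH AN ORPHAN BLOCK, FOR EVERY LETTER RECORD.**  If the block `s ∈ 𝔅` contains the fine bond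
`x₀` and is the carrier block `β c` of NO index bond `c`, then for every `𝔏 : CovLettersY 𝔸 x` (printed U = 1 clause `GA_one`), every `𝔈` and every
choice of block pieces `res`, `GlobReading (operatorLayerYOfLetters 𝔸 G x 𝔏 𝔈).GA (fun λ => λ.isRight = true) 1 res` FAILS: with `K = 𝟙_{x₀}`,
`J = Δ_a K`, the field `glob_le` at `n = 0, γ = 0, C = 0` has its hypothesis satisfied (every carrier-block reading of `G(1)(J ⊗ E) = K ⊗ E` is 0)
and its conclusion `|K ⊗ E|_{(2)} ≤ 0 for all E` violated at `E₀ = ‖1‖⁻¹·1` (value `≥ (L^{j(x₀)}|c_f|⁻¹)⁻² > 0`).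
[cite: Balaban1985BackgroundPropagators, (3.41)–(3.42) p.397 + (3.47) p.398 + Cor. 3.5 p.407; Balaban1984PropagatorsII, (2.22) p.226] -/
theorem not_globReading_GA_one_of_orphan {s : BlkY x.toKIdx} (hs : ∀ c : IBondY x.toKIdx, β x.hN x.D x.hk c ≠ s)
    {x₀ : FBondY x.toKIdx} (hx₀ : blkV1 x.hN x.D x₀ = s) (res : (geo9Y x).Site → (geo9Y x).Loc → (geo9Y x).Loc) :
    ¬ GlobReading (operatorLayerYOfLetters 𝔸 G x 𝔏 𝔈).GA (fun lam => lam.isRight = true) (bg9Y 𝔸 G x).one res := by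
  classical
  intro hR
  -- the test functions: `K = 𝟙_{x₀}` on the orphan block, `J = Δ_a K`, so that `G(1)J = K`
  set K : FBondY x.toKIdx → ℝ := fun x' => if x' = x₀ then 1 else 0 with hKdef
  set J : FBondY x.toKIdx → ℝ := onFun (deltaAE (domT x.hN x.D x.hk) x.cf x.w) K with hJdef
  have hGJ : Gop x.toKIdx J = K := Gop_onFun_deltaAE x.toKIdx K
  have hKoff : ∀ (c : IBondY x.toKIdx) (x' : FBondY x.toKIdx), blkV1 x.hN x.D x' = β x.hN x.D x.hk c → K x' = 0 := by
    intro c x' hx'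
    simp only [hKdef]
    split_ifs with h
    · exact absurd (hx'.symm.trans (h ▸ hx₀)) (hs c)
    · rfl
  -- every carrier-block reading of entry (3.42)₁ of `G(1)(J ⊗ ·)` vanishes
  have he : ∀ c : (geo9Y x).Site, (operatorLayerYOfLetters 𝔸 G x 𝔏 𝔈).GA.e 0 (bg9Y 𝔸 G x).one (Sum.inr J) c ≤
      0 * B9.pref4 ((geo9Y x).len c) 0 * ((geo9Y x).len c) ^ (0 : ℝ) := by
    intro c
    rw [zero_mul, zero_mul]
    show (⨆ E : BallY 𝔸, ((![supInB x.toKIdx (β x.hN x.D x.hk c) (𝔏.GA (fun _ _ => 1) (liftY J (E : 𝔸))),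
        ⨆ ν : Fin (d + 1), supInB x.toKIdx (β x.hN x.D x.hk c) (Node00.cdB x.toKIdx (fun _ _ => 1) ν (𝔏.GA (fun _ _ => 1) (liftY J (E : 𝔸)))),
        ⨆ ν : Fin (d + 1), supInB x.toKIdx (β x.hN x.D x.hk c) (𝔏.GA (fun _ _ => 1) (Node00.cdsB x.toKIdx (fun _ _ => 1) ν (liftY J (E : 𝔸)))),
        supInB x.toKIdx (β x.hN x.D x.hk c) (Node00.lapB x.toKIdx (fun _ _ => 1) (𝔏.GA (fun _ _ => 1) (liftY J (E : 𝔸))))] : Fin 4 → ℝ) 0)) ≤ 0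
    refine Real.iSup_le (fun E => ?_) le_rfl
    simp only [Matrix.cons_val_zero]
    rw [𝔏.GA_one, hGJ, supInB_liftY_eq_zero_of_off x.toKIdx (hKoff c)]
  -- `glob_le` at n = 0, γ = 0, C = 0
  have hglob := hR.glob_le 0 (Sum.inr J) 0 0 rfl le_rfl he
  rw [GA_glob_one_inr] at hglob
  -- the family under the sup, entry 0, is `E ↦ |K ⊗ E|_{(2)}`: bounded by `|K|_{(2)}` and positive at `E₀`
  set F : BallY 𝔸 → ℝ := fun E => wNormBY x.toKIdx (2 + 0) (𝔏.GA (fun _ _ => 1) (liftY J (E : 𝔸))) with hFdef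
  have hFeq : ∀ E : BallY 𝔸, F E = wNormBY x.toKIdx (2 + 0) (liftY K (E : 𝔸)) := by
    intro E
    simp only [hFdef]
    rw [𝔏.GA_one, hGJ]
  have hbdd : BddAbove (Set.range F) := by
    refine ⟨wNormB x.toKIdx (2 + 0) K, ?_⟩
    rintro _ ⟨E, rfl⟩
    rw [hFeq]
    exact wNormBY_liftY_le_wNormB x.toKIdx (2 + 0) K E
  have hsup : (⨆ E : BallY 𝔸, F E) ≤ 0 := by
    refine le_trans (le_of_eq ?_) hglob
    refine iSup_congr fun E => ?_
    simp only [hFdef, Matrix.cons_val_zero]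
  -- the unit direction
  set E₀ : BallY 𝔸 := ⟨((‖(1 : 𝔸)‖⁻¹ : ℝ) : ℂ) • (1 : 𝔸), unitDir_mem⟩ with hE₀def
  have hpos : 0 < F E₀ := by
    rw [hFeq]
    have hw : 0 < weight (ℓ + 1) |x.cf|⁻¹ (2 + 0) (blkV1 x.hN x.D x₀).1.1 :=
      weight_pos (Nat.succ_le_succ (Nat.zero_le ℓ)) (inv_pos.2 (abs_pos.2 x.hcf)) _ _
    have hval : ‖liftY K (E₀ : 𝔸) x₀‖ = 1 := by
      rw [liftY_apply]
      simp only [hKdef, if_true, Complex.ofReal_one, one_smul, hE₀def]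
      exact norm_unitDir
    have h := weight_mul_norm_le_wNormBY x.toKIdx (2 + 0) (liftY K (E₀ : 𝔸)) x₀
    rw [hval, mul_one] at h
    exact lt_of_lt_of_le hw h
  have hle : F E₀ ≤ ⨆ E : BallY 𝔸, F E := le_ciSup hbdd E₀
  linarith

end Member

/-! ## §3 ★ At the record: the knit binder `hRGA x` is unsatisfiable at a member with an orphan block, for every `𝔏 𝔈` -/

section Record

open scoped Matrix.Norms.L2Operator

variable (N : ℕ) (θ : Stage3Params) (Mstar : ℕ) (𝔏 : LettersY N θ Mstar) (𝔈 : ExpsY N θ Mstar)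
variable [∀ x : MemberY θ.d₆ θ.ℓ₆ θ.hd' θ.hL' θ.b₀ θ.b₁ Mstar, Fintype (geo9Y x).Site]

/-- ★ **THE KNIT BINDER `hRGA x` (rows 12 of n06-d's `…AtOpsYOfLetters*` knits: `GlobReading ((opsYOfLetters N θ M⋆ 𝔏 𝔈) x).GA (isRight) 1 (res x)`)
IS UNSATISFIABLE AT EVERY MEMBER WITH AN ORPHAN BLOCK**, for every letter record `𝔏`, every `𝔈`, every `res` (`N ≥ 1`).
[cite: Balaban1985BackgroundPropagators, (3.41)–(3.42) p.397 + (3.47) p.398 + Cor. 3.5 p.407; Balaban1984PropagatorsII, (2.22) p.226] -/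
theorem not_hRGA_opsYOfLetters_of_orphan (hN : 1 ≤ N) (x : MemberY θ.d₆ θ.ℓ₆ θ.hd' θ.hL' θ.b₀ θ.b₁ Mstar)
    {s : BlkY x.toKIdx} (hs : ∀ c : IBondY x.toKIdx, β x.hN x.D x.hk c ≠ s) {x₀ : FBondY x.toKIdx} (hx₀ : blkV1 x.hN x.D x₀ = s)
    (res : (geo9Y x).Site → (geo9Y x).Loc → (geo9Y x).Loc) :
    ¬ GlobReading ((opsYOfLetters N θ Mstar 𝔏 𝔈) x).GA (fun lam => lam.isRight = true)
      (bg9Y (Matrix (Fin N) (Fin N) ℂ) (specialUnitaryUnits (Fin N)) x).one res := by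
  haveI : Nonempty (Fin N) := ⟨⟨0, hN⟩⟩
  exact not_globReading_GA_one_of_orphan x (𝔏 x) (𝔈 x) hs hx₀ res

end Record

end Literature.MathematicalPhysics.QuantumFieldTheory.Balaban1983to89.B9GlobReadingOrphan

end
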